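import Mathlib
import HarnessLib
import Literature.Computability.LopesEtAl2021.Refinement

/-!
# Lee et al. 2017: the poison-only value domain `⟦isz⟧ = Num(sz) ⊎ {poison}`, `freeze`, and the semantics of `select` (scalar integer fragment)

Source followed verbatim: J. Lee, Y. Kim, Y. Song, C.-K. Hur, S. Das, D. Majnemer, J. Regehr, N. P. Lopes,
*Taming Undefined Behavior in LLVM*, PLDI 2017 [LeeEtAl2017] — §4 (Proposed Semantics), Fig. 4 (§4.1, syntax),
§4.2 (semantic domains), Fig. 5 (semantics of selected instructions), §3.4 (select and poison).

Printed (§4, p. 7 of the author copy): "• Remove undef and use poison instead. • Introduce a new instruction: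
`%y = freeze %x` — freeze is a nop unless its input is poison, in which case it non-deterministically chooses an
arbitrary value of the type. All uses of a given freeze return the same value, but different freezes of a value
may return different constants. • All operations over poison unconditionally return poison except phi, select,
and freeze. • Branching on poison is immediate UB."  "We define phi and select to conditionally return poison,
and branching on poison to be UB, because these decisions reduce the number of freeze instructions that would
otherwise be needed."
Printed (§4.2): `Num(sz) ::= {i | 0 ≤ i < 2^sz}`, `⟦isz⟧ ::= Num(sz) ⊎ {poison}`, "Here ⟦ty⟧ denotes the set of
values of type ty, which are either poison or fully defined for base types".
Printed (Fig. 5, "Semantics of selected instructions", `R, M ↪ R′, M′`): `(r = freeze isz op)`: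
`⟦op⟧R = poison, v ∈ Num(sz) ⟹ R[r ↦ v]`; `⟦op⟧R = v ≠ poison ⟹ R[r ↦ v]`.  `(r = select op, ty op1, op2)`:
`⟦op⟧R = poison ⟹ R[r ↦ poison]`; `⟦op⟧R = 1, ⟦op1⟧R = v1 ⟹ R[r ↦ v1]`; `⟦op⟧R = 0, ⟦op2⟧R = v2 ⟹ R[r ↦ v2]`.
`(r = and isz op1, op2)`: `⟦op1⟧R = poison ⟹ poison`; `⟦op2⟧R = poison ⟹ poison`;
`⟦op1⟧R = v1 ≠ poison, ⟦op2⟧R = v2 ≠ poison ⟹ R[r ↦ v1 & v2]`.  `(r = add nsw isz op1, op2)`: poison operands ↦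
poison; "`v1 + v2` overflows (signed)" ↦ poison; "no signed overflow" ↦ `v1 + v2`.
Printed (§3.4): "For this transformation [phi/branch ⟹ select, SimplifyCFG] to be correct, select on poison
cannot be UB if branching on poison is not. Moreover, it can only be poison when the chosen value at runtime is
poison (in order to match the behavior of phi)."  "it is often desirable to view select as arithmetic, allowing
transformations like: `%x = select %c, true, %b` to `%x = or %c, %b`. This property of equivalence with
arithmetic, however, requires making the return value poison if any of the arguments is poison, which breaks
soundness for the phi/branch to select transformation".  "the following transformation that replaces an unsigned
division with a comparison … ought to be valid for any constant `C < 0`: `%r = udiv %a, C` to: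
`%c = icmp ult %a, C; %r = select %c, 0, 1`".

## What is formalised (special case) and what is not
Scalar integer types `isz` only: no pointers `ty∗`, no vectors `⟨sz × ty⟩`, no memory (`load`/`store`/`bitcast`
rules of Fig. 5 omitted), no `phi` (needs control flow; its scalar content — return the incoming value, poison or
not — is the same "conditionally poison" behaviour as `select`'s).  The domain `⟦isz⟧` is rendered as
`Option (BitVec sz)` with `none` = poison; it is an `abbrev`, so models that use `Option (BitVec w)` for LLVM
integers (lean-mlir; the CertifiedToolchain cell's `PVal w`) ARE this domain by `rfl`.  Non-determinism of
`freeze` is rendered as the predicate `FreezeResult` ("the register may receive `v`").  Signed overflow in the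
add-nsw rule is Lean core's `BitVec.saddOverflow` (SMT-LIB `bvsaddo`).  This is the proposal LLVM adopted (LangRef
"Poison Values") and the behaviour Alive2 implements on non-undef values; the embedding into Alive2's value-SET
domain (which additionally has `undef`) is `LopesEtAl2021.Val.ofOption`, and `freezeResult_iff_freezePre` records
that the 2017 freeze rule and Alive2's freeze-poison / freeze-pick agree there.  The refinement/correctness notion
is NOT defined in this paper's excerpted sections and is not restated here (see `LopesEtAl2021`).
-/

namespace Literature.Computability.LeeEtAl2017

/-- `⟦isz⟧ ::= Num(sz) ⊎ {poison}`: a value of an integer base type is "either poison or fully defined"; `none`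
is poison, `some v` the number `v ∈ Num(sz)`. [cite: LeeEtAl2017, §4.2] -/
abbrev IVal (sz : ℕ) := Option (BitVec sz)

namespace IVal

variable {sz sz' : ℕ}

/-- The poison value of `⟦isz⟧`. [cite: LeeEtAl2017, §4.2] -/
@[match_pattern, reducible] def poison : IVal sz := none

/-- `poison` is the `none` of the `Option` rendering. [cite: LeeEtAl2017, §4.2] -/
@[simp] theorem poison_eq_none : (poison : IVal sz) = none := rfl

/-! ## "All operations over poison unconditionally return poison except phi, select, and freeze" (§4) -/

/-- The poison-STRICT lift of a binary operation on defined values (the operation may itself produce poison, as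
`add nsw` does): the shape of every Fig. 5 rule other than freeze / phi / select — "`⟦op1⟧R = poison ⟹
R[r ↦ poison]`; `⟦op2⟧R = poison ⟹ R[r ↦ poison]`; `⟦op1⟧R = v1 ≠ poison, ⟦op2⟧R = v2 ≠ poison ⟹ R[r ↦ …]`".
[cite: LeeEtAl2017, §4 and Figure 5] -/
def strict₂ (f : BitVec sz → BitVec sz → IVal sz') (a b : IVal sz) : IVal sz' :=
  a.bind fun v₁ => b.bind fun v₂ => f v₁ v₂

/-- First operand poison ⟹ poison. [cite: LeeEtAl2017, Figure 5] -/
@[simp] theorem strict₂_poison_left (f : BitVec sz → BitVec sz → IVal sz') (b : IVal sz) :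
    strict₂ f poison b = poison := rfl

/-- Second operand poison ⟹ poison. [cite: LeeEtAl2017, Figure 5] -/
@[simp] theorem strict₂_poison_right (f : BitVec sz → BitVec sz → IVal sz') (a : IVal sz) :
    strict₂ f a poison = poison := by cases a <;> rfl

/-- Both operands defined ⟹ the operation's own clause. [cite: LeeEtAl2017, Figure 5] -/
@[simp] theorem strict₂_some_some (f : BitVec sz → BitVec sz → IVal sz') (v₁ v₂ : BitVec sz) :
    strict₂ f (some v₁) (some v₂) = f v₁ v₂ := rfl

/-- A strict operation is poison iff an operand is poison or its own clause yields poison (the three printed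
premises of a Fig. 5 strict rule, read backwards). [cite: LeeEtAl2017, Figure 5] -/
theorem strict₂_eq_poison_iff (f : BitVec sz → BitVec sz → IVal sz') (a b : IVal sz) :
    strict₂ f a b = poison ↔ ∀ v₁ v₂, a = some v₁ → b = some v₂ → f v₁ v₂ = poison := by
  cases a <;> cases b <;> simp [strict₂]

/-- Fig. 5 rule `(r = and isz op1, op2)`: poison if either operand is poison, otherwise `v1 & v2`.
[cite: LeeEtAl2017, Figure 5] -/
def and (a b : IVal sz) : IVal sz := strict₂ (fun v₁ v₂ => some (v₁ &&& v₂)) a b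

/-- and: `⟦op1⟧R = v1 ≠ poison, ⟦op2⟧R = v2 ≠ poison ⟹ R[r ↦ v1 & v2]`. [cite: LeeEtAl2017, Figure 5] -/
@[simp] theorem and_some_some (v₁ v₂ : BitVec sz) : and (some v₁) (some v₂) = some (v₁ &&& v₂) := rfl
/-- and: `⟦op1⟧R = poison ⟹ R[r ↦ poison]`. [cite: LeeEtAl2017, Figure 5] -/
@[simp] theorem and_poison_left (b : IVal sz) : and poison b = poison := rfl
/-- and: `⟦op2⟧R = poison ⟹ R[r ↦ poison]`. [cite: LeeEtAl2017, Figure 5] -/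
@[simp] theorem and_poison_right (a : IVal sz) : and a poison = poison := by cases a <;> rfl

/-- The same strict shape for `or` (Fig. 4 `binop ::= add | udiv | sdiv | shl | and | or`; §4: poison-strict).
[cite: LeeEtAl2017, §4 and Figure 4] -/
def or (a b : IVal sz) : IVal sz := strict₂ (fun v₁ v₂ => some (v₁ ||| v₂)) a b

/-- or on defined operands. [cite: LeeEtAl2017, §4 and Figure 4] -/
@[simp] theorem or_some_some (v₁ v₂ : BitVec sz) : or (some v₁) (some v₂) = some (v₁ ||| v₂) := rfl
/-- or with a poison first operand is poison (§4: strict). [cite: LeeEtAl2017, §4] -/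
@[simp] theorem or_poison_left (b : IVal sz) : or poison b = poison := rfl
/-- or with a poison second operand is poison (§4: strict). [cite: LeeEtAl2017, §4] -/
@[simp] theorem or_poison_right (a : IVal sz) : or a poison = poison := by cases a <;> rfl

/-- Fig. 5 rule `(r = add nsw isz op1, op2)`: poison operands ↦ poison; "`v1 + v2` overflows (signed)" ↦ poison;
"no signed overflow" ↦ `v1 + v2`.  Signed overflow of the exact sum = Lean core `BitVec.saddOverflow`
(`x.toInt + y.toInt ∉ [−2^(sz−1), 2^(sz−1))`). [cite: LeeEtAl2017, Figure 5] -/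
def addNsw (a b : IVal sz) : IVal sz :=
  strict₂ (fun v₁ v₂ => if BitVec.saddOverflow v₁ v₂ then poison else some (v₁ + v₂)) a b

/-- add-nsw on defined operands that overflow is poison. [cite: LeeEtAl2017, Figure 5] -/
theorem addNsw_of_overflow {v₁ v₂ : BitVec sz} (h : BitVec.saddOverflow v₁ v₂ = true) :
    addNsw (some v₁) (some v₂) = poison := by
  simp [addNsw, h]

/-- add-nsw on defined operands without signed overflow is the sum. [cite: LeeEtAl2017, Figure 5] -/
theorem addNsw_of_not_overflow {v₁ v₂ : BitVec sz} (h : BitVec.saddOverflow v₁ v₂ = false) :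
    addNsw (some v₁) (some v₂) = some (v₁ + v₂) := by
  simp [addNsw, h]

/-- Fig. 4's `udiv` under §4 (poison-strict); division by zero is immediate UB in LLVM and is NOT modelled by this
value-level function (callers exclude a zero divisor, as §3.4's example does with "any constant `C < 0`").
[cite: LeeEtAl2017, §4 and Figure 4] -/
def udiv (a b : IVal sz) : IVal sz := strict₂ (fun v₁ v₂ => some (v₁ / v₂)) a b

/-- udiv on defined operands (non-zero divisor understood). [cite: LeeEtAl2017, §4 and Figure 4] -/
@[simp] theorem udiv_some_some (v₁ v₂ : BitVec sz) : udiv (some v₁) (some v₂) = some (v₁ / v₂) := rfl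
/-- udiv of a poison dividend is poison (§4: strict) — the source side of §3.4's example. [cite: LeeEtAl2017, §4 and §3.4] -/
@[simp] theorem udiv_poison_left (b : IVal sz) : udiv poison b = poison := rfl

/-- Fig. 4's `icmp cond, op, op` (`cond ::= eq | ne | ugt | uge | slt | sle`) under §4: poison-strict, otherwise
the 1-bit result of the comparison `r`. [cite: LeeEtAl2017, §4 and Figure 4] -/
def icmp (r : BitVec sz → BitVec sz → Bool) (a b : IVal sz) : IVal 1 :=
  strict₂ (fun v₁ v₂ => some (BitVec.ofBool (r v₁ v₂))) a b

/-- icmp on defined operands is the defined 1-bit comparison result. [cite: LeeEtAl2017, §4 and Figure 4] -/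
@[simp] theorem icmp_some_some (r : BitVec sz → BitVec sz → Bool) (v₁ v₂ : BitVec sz) :
    icmp r (some v₁) (some v₂) = some (BitVec.ofBool (r v₁ v₂)) := rfl
/-- icmp with a poison first operand is poison (§4: strict). [cite: LeeEtAl2017, §4] -/
@[simp] theorem icmp_poison_left (r : BitVec sz → BitVec sz → Bool) (b : IVal sz) : icmp r poison b = poison := rfl
/-- icmp with a poison second operand is poison (§4: strict). [cite: LeeEtAl2017, §4] -/
@[simp] theorem icmp_poison_right (r : BitVec sz → BitVec sz → Bool) (a : IVal sz) :
    icmp r a poison = poison := by cases a <;> rfl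

/-! ## `select`: conditionally poison (Fig. 5, §3.4, §4) -/

/-- Fig. 5 rule `(r = select op, ty op1, op2)`, scalar case: `⟦op⟧R = poison ⟹ R[r ↦ poison]`;
`⟦op⟧R = 1, ⟦op1⟧R = v1 ⟹ R[r ↦ v1]`; `⟦op⟧R = 0, ⟦op2⟧R = v2 ⟹ R[r ↦ v2]` — `v1`, `v2` range over `⟦ty⟧`
INCLUDING poison and the operand not selected is not inspected ("it can only be poison when the chosen value at
runtime is poison", §3.4; "We define phi and select to conditionally return poison", §4).  The condition is an
`i1`, i.e. an element of `⟦i1⟧ = IVal 1`. [cite: LeeEtAl2017, Figure 5, §3.4 and §4] -/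
def select (c : IVal 1) (a b : IVal sz) : IVal sz :=
  c.bind fun t => if t = 1#1 then a else b

/-- select on a poison condition is poison. [cite: LeeEtAl2017, Figure 5] -/
@[simp] theorem select_poison (a b : IVal sz) : select poison a b = poison := rfl

/-- select on `1` returns the first operand's value, whatever it is. [cite: LeeEtAl2017, Figure 5] -/
@[simp] theorem select_one (a b : IVal sz) : select (some 1#1) a b = a := rfl

/-- select on `0` returns the second operand's value, whatever it is. [cite: LeeEtAl2017, Figure 5] -/
@[simp] theorem select_zero (a b : IVal sz) : select (some 0#1) a b = b := rfl

/-- The two defined-condition rules of Fig. 5 with the condition read through `BitVec.ofBool` (how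
`Option Bool`-based models present an `i1`): `true ↦ op1`, `false ↦ op2`. [cite: LeeEtAl2017, Figure 5] -/
@[simp] theorem select_ofBool (t : Bool) (a b : IVal sz) :
    select (some (BitVec.ofBool t)) a b = if t then a else b := by
  cases t <;> rfl

/-- The NOT-selected operand does not taint the result: `select 1, v1, poison = v1` — select is not
poison-strict (contrast `strict₂_poison_right`). [cite: LeeEtAl2017, §3.4 and Figure 5] -/
theorem select_one_poison_right (a : IVal sz) : select (some 1#1) a poison = a := rfl

/-- … and `select 0, poison, v2 = v2`. [cite: LeeEtAl2017, §3.4 and Figure 5] -/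
theorem select_zero_poison_left (b : IVal sz) : select (some 0#1) poison b = b := rfl

/-- select is poison iff its condition is poison or the CHOSEN operand is poison. [cite: LeeEtAl2017, §3.4] -/
theorem select_eq_poison_iff (c : IVal 1) (a b : IVal sz) :
    select c a b = poison ↔ c = poison ∨ (c = some 1#1 ∧ a = poison) ∨ (c = some 0#1 ∧ b = poison) := by
  rcases c with _ | t
  · simp
  · have ht : t = 0#1 ∨ t = 1#1 := by
      rcases BitVec.eq_zero_or_eq_one t with h | h
      · exact Or.inl h
      · exact Or.inr h
    rcases ht with rfl | rfl <;> simp [select]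

/-! ## `freeze` (Fig. 5) and "Branching on poison is immediate UB" (§4) -/

/-- Fig. 5 rule `(r = freeze isz op)` as the set of values the destination register may receive:
`⟦op⟧R = poison, v ∈ Num(sz) ⟹ R[r ↦ v]` (ANY `v` — "non-deterministically chooses an arbitrary value of the
type", §4) and `⟦op⟧R = v ≠ poison ⟹ R[r ↦ v]` ("a nop").  The result is never poison.  "All uses of a given
freeze return the same value, but different freezes of a value may return different constants" (§4): one pick per
freeze INSTRUCTION, shared by its uses. [cite: LeeEtAl2017, Figure 5 and §4] -/
def FreezeResult (a : IVal sz) (v : BitVec sz) : Prop :=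
  match a with
  | none => True
  | some u => v = u

/-- freeze of poison may yield any value. [cite: LeeEtAl2017, Figure 5] -/
@[simp] theorem freezeResult_poison (v : BitVec sz) : FreezeResult poison v := trivial

/-- freeze of a defined value yields that value. [cite: LeeEtAl2017, Figure 5] -/
@[simp] theorem freezeResult_some_iff (u v : BitVec sz) : FreezeResult (some u) v ↔ v = u := Iff.rfl

/-- Every operand admits at least one freeze result (the instruction never blocks). [cite: LeeEtAl2017, Figure 5] -/
theorem freezeResult_getD (a : IVal sz) (d : BitVec sz) : FreezeResult a (a.getD d) := by
  cases a
  · exact trivial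
  · rfl

/-- The 2017 freeze rule and Alive2's freeze-poison / freeze-pick (PLDI 2021, Fig. 3) agree on the `⊎ {poison}`
domain embedded by `Val.ofOption`: the admissible results / picks coincide. [cite: LeeEtAl2017, Figure 5]
[cite: LopesEtAl2021, Figure 3 (freeze-poison, freeze-pick)] -/
theorem freezeResult_iff_freezePre (a : IVal sz) (v : BitVec sz) :
    FreezeResult a v ↔ LopesEtAl2021.Val.FreezePre (LopesEtAl2021.Val.ofOption a) v := by
  cases a with
  | none => exact Iff.intro (fun _ => trivial) (fun _ => trivial)
  | some u =>
    change v = u ↔ v ∈ ({u} : Set (BitVec sz))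
    rw [Set.mem_singleton_iff]

/-- §4: "Branching on poison is immediate UB"; by §3.4 "the behavior of branching on poison and select with a
poison condition has to be equivalent" — and indeed select on poison is poison (`select_poison`), the value-level
counterpart. [cite: LeeEtAl2017, §4 and §3.4] -/
def BranchUB (c : IVal 1) : Prop := c = poison

/-- Unfolding of `BranchUB`. [cite: LeeEtAl2017, §4] -/
@[simp] theorem branchUB_iff (c : IVal 1) : BranchUB c ↔ c = none := Iff.rfl

/-! ## §3.4's three transformations under the adopted semantics -/

/-- SimplifyCFG (phi/branch ⟹ select, §3.4) is compatible with Fig. 5: on a defined condition select returns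
exactly the incoming value a phi would (poison or not), and on a poison condition the source BRANCH was UB (§4), so
any target value is allowed. [cite: LeeEtAl2017, §3.4 and Figure 5] -/
theorem select_eq_phi_of_defined (t : BitVec 1) (a b : IVal sz) :
    select (some t) a b = (if t = 1#1 then a else b) := rfl

/-- "`%x = select %c, true, %b` to `%x = or %c, %b`" is NOT valid under Fig. 5 ("requires making the return
value poison if any of the arguments is poison"): with `c = 1` and `b = poison` the source is the defined value
`true` while the target is poison. [cite: LeeEtAl2017, §3.4] -/
theorem select_true_to_or_invalid :
    ∃ c b : IVal 1, select c (some 1#1) b = some 1#1 ∧ or c b = poison :=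
  ⟨some 1#1, poison, rfl, rfl⟩

/-- The arithmetic fact §3.4's `udiv ⟹ icmp ult + select` example rests on ("ought to be valid for any
constant `C < 0`"): for a divisor with the sign bit set, `a /u C` is `0` if `a <u C` and `1` otherwise — at every
width (our proof of the printed claim's arithmetic content). [cite: LeeEtAl2017, §3.4] -/
theorem udiv_eq_ite_of_msb {sz : ℕ} (a C : BitVec sz) (hC : C.msb = true) :
    a / C = if a.toNat < C.toNat then 0#sz else 1#sz := by
  have hsz : 0 < sz := by
    rcases Nat.eq_zero_or_pos sz with h | h
    · subst h; simp [BitVec.msb_eq_decide, BitVec.eq_nil C] at hC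
    · exact h
  have hCge : 2 ^ (sz - 1) ≤ C.toNat := BitVec.msb_eq_true_iff_two_mul_ge.mp hC |> fun h => by
    have : 2 * 2 ^ (sz - 1) = 2 ^ sz := by
      rw [← Nat.pow_succ']; congr 1; omega
    omega
  have ha : a.toNat < 2 ^ sz := a.isLt
  have h2 : 2 ^ sz = 2 * 2 ^ (sz - 1) := by rw [← Nat.pow_succ']; congr 1; omega
  apply BitVec.eq_of_toNat_eq
  rw [BitVec.toNat_udiv]
  split
  · rename_i hlt
    rw [BitVec.toNat_ofNat, Nat.zero_mod]
    exact Nat.div_eq_of_lt hlt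
  · rename_i hge
    rw [not_lt] at hge
    rw [BitVec.toNat_ofNat, Nat.one_mod_two_pow hsz]
    refine Nat.div_eq_of_lt_le (by omega) (by omega)

/-- §3.4: "`%r = udiv %a, C` to: `%c = icmp ult %a, C; %r = select %c, 0, 1`" "ought to be valid for any
constant `C < 0`" — and under Fig. 5 it is, value for value: for poison `%a` both sides are poison (udiv is
strict; select on the poison comparison is poison, NOT UB), for defined `%a` both are the same number.
[cite: LeeEtAl2017, §3.4] -/
theorem udiv_to_select_valid {sz : ℕ} (a : IVal sz) (C : BitVec sz) (hC : C.msb = true) :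
    select (icmp (fun x y => decide (x.toNat < y.toNat)) a (some C)) (some 0#sz) (some 1#sz)
      = udiv a (some C) := by
  cases a with
  | none => rfl
  | some v =>
    rw [icmp_some_some, select_ofBool, udiv_some_some, udiv_eq_ite_of_msb v C hC]
    by_cases h : v.toNat < C.toNat <;> simp [h]

/-- Width 8 instance of the previous theorem's content: `200 /u 0x90 = 1`, `100 /u 0x90 = 0`. -/
example : (200#8) / (0x90#8) = 1#8 ∧ (100#8) / (0x90#8) = 0#8 := by decide

end IVal

end Literature.Computability.LeeEtAl2017
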